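import Summits.QuantumFields.BalabanUV.Beta.FP.HorizontalBookkeepingTailPointwise

/-!
# `BalabanUV.Beta.FP.HorizontalBookkeepingTailSum` — road «FP», N7 H-route, row H3-BOOK (b-T), (T1)+(T2)+(T3): THE POINTWISE BOUND EVERYWHERE
# (`A_T·(‖v‖∞+1)⁻⁷`, `N`-free), ITS SUM AGAINST `v_μv_ν` ON `ℤ⁴` (every finite window and the `tsum`, `≤ 161·A_T`), AND THE SPLIT
# `dressedEntry w K = dressedEntry w (truncK K N) + dressedEntry w (K − truncK K N)` ([folklore] lattice bookkeeping; nothing of the manuscripts)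

HONEST DEPENDENCY (page 1, mandatory): continuum YM on T⁴ ⇐ BetaPertH ∧ nine spine estimates (0/9 proved); BetaPertH ⇐ (D1) ∧ (D4) ∧
CAP+tail; G-an2-4 gates asym, D1 and NE2/3/4.  HONEST FRAMING (cell contract, verbatim): «discharging `BetaPertH` makes Bałaban's UV
stability UNCONDITIONAL — a real constructive-QFT result; it is NOT the continuum limit and NOT the Clay problem.»  THIS MODULE composes BY NAME
`FP/HorizontalBookkeepingTailPointwise` (outer + core bounds) with the tree's `d = 4` shell arithmetic `TransferUV.abs_sum_le_of_quintic` (`#shell ≤ 80(r+1)³`,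
one power better than marginal is `O(1)` uniformly in the window) and Mathlib's `summable_of_sum_le`.  Every analytic input is a HYPOTHESIS displayed in the
signatures; it cites nothing, defines nothing, mints no `Prop` fact, 0 sorry.  THIS IS THE (b-T) HALF of row H3-BOOK (b): the comparison is against the
RESCALED tail kernel `Q_N a b v := N⁶·(K − truncK K N) a b (N•v)`, NOT against `K(v)` — the passage `M₂[Q_N] ↔ M₂[K·1_{>N}]`/`hbook` needs the
homogeneity ∕ `hgerm` letter and is leaf-05's (b3′)/(b4′) (its finding F-d1leaf05g8-1, concurred).  NOT `hbook`, NOT `hasym`, NOT D1, NOT BetaPertH, NOT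
continuum, NOT Clay.

CONTENT.
* §7 **`abs_transport_tail_sub_le`** — ALL `v`: `|N⁸·dressedEntry w (K − truncK K N) (N•v) a b − N⁶·(K − truncK K N) a b (N•v)| ≤ A_T/(‖v‖∞+1)⁷`,
  `A_T := 4⁷·(16Cc²β₀² + C) + (5/4)⁷·A_out`, for every `N ≥ 1` (hypotheses: `|K| ≤ C(‖t‖∞+1)⁻⁶`, `|Δ_iK| ≤ C(‖t‖∞+1)⁻⁷`, masses (L0∞) `δ_{κl}N⁻⁵`,
  profile `|w κ l x| ≤ (c/N⁵)e^{−(δ/N)|x|₁}`); `tail_apply_coarse` (dictionary: `(K − truncK K N) a b (N•v) = if ‖v‖∞ ≤ 1 then 0 else K a b (N•v)`).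
* §8 `sum_abs_le_of_quintic` ∕ `summable_of_quintic` (`|g v| ≤ A(‖v‖∞+1)⁻⁵` on `ℤ⁴` ⟹ `Σ_{v∈S}|g v| ≤ 161A` for EVERY finite `S`, `Summable g`,
  `|Σ'g| ≤ 161A`) and **`summable_weight_transport_tail_sub`** — the row's (T2): for `g v := (v_μv_ν)·(N⁸·dressedEntry w (K − truncK K N) (N•v) a b −
  N⁶·(K − truncK K N) a b (N•v))`: `|g v| ≤ A_T(‖v‖∞+1)⁻⁵`, `Summable g`, `|Σ' g| ≤ 161·A_T`, and `|Σ_{v∈S} g v| ≤ 161·A_T` for EVERY finite window `S ⊆ ℤ⁴`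
  (leaf-05's `annulus 4 1 R′` included) — uniformly in `N ≥ 1` and in the window.
* §9 `abs_le_of_decay`, **`dressedEntry_truncK_add_tail`** — (T3): `dressedEntry w (truncK K N) y a b + dressedEntry w (K − truncK K N) y a b = dressedEntry w K y a b`
  (summable fibres for BOUNDED kernels), so that g5's (a) `HorizontalBookkeeping.hasSum_coarse_secondMoment_truncK` and (T2) recombine to the full transported
  kernel of the (H1)-socket.
Unit `b2b-balaban-beta-d1-formalise-leaf-02` (gen 6).
-/

noncomputable section

namespace Summit.QuantumFields.BalabanUV.Beta.FP.HorizontalBookkeepingTailSum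

open Finset Filter Topology
open scoped BigOperators
open Literature.MathematicalPhysics.QuantumFieldTheory.Balaban1983to89
open Literature.MathematicalPhysics.QuantumFieldTheory.Balaban1983to89.Beta
open B12Sec2to5 (l1 l1_nonneg abs_coord_le_l1)
open ExpKernelCalculus (Site Zl Zl_pos l1_sub_triangle l1_sub_symm)
open DecimatedMomentSummable (dressedSum ConstReproSum)
open DressedMomentNormalisation (EKer dressedEntry hasSum_total_of_constReproSum)
open Summit.QuantumFields.BalabanUV.Beta.FP.HorizontalBookkeeping (truncK truncK_apply)
open Summit.QuantumFields.BalabanUV.Beta.FP.HorizontalBookkeepingTail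
open Summit.QuantumFields.BalabanUV.Beta.FP.HorizontalBookkeepingTailPointwise

/-! ## §7 Everywhere: one `N`-free constant against `(‖v‖∞+1)⁻⁷` -/

section Everywhere

open DyadicShell (Pt supNorm supNorm_eq_zero_iff natAbs_le_supNorm mem_box_iff mem_annulus_iff supNorm_pos supNorm_eq_of_mem_sphere)
open Literature.Probability.LatticeModels (box annulus)

/-- **THE POINTWISE TRANSPORT COMPARISON OF THE TAIL, ALL `v`** (row H3-BOOK (b-T), (T1)): for `K : EKer 4` with `|K| ≤ C(‖t‖∞+1)⁻⁶`,
`|Δ_i K| ≤ C(‖t‖∞+1)⁻⁷`, transport entries with the Kronecker masses (L0∞) `δ_{κl}·N⁻⁵` and the profile `|w κ l x| ≤ (c/N⁵)·e^{−(δ/N)|x|₁}`, and EVERY `N ≥ 1`,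
`v ∈ ℤ⁴`, `a b`:
`|N⁸·dressedEntry w (K − truncK K N) (N•v) a b − N⁶·(K − truncK K N) a b (N•v)| ≤ A_T/(‖v‖∞+1)⁷`,
`A_T := 4⁷·(16·C·c²·β₀² + C) + (5/4)⁷·A_out` (`β₀ = e^{δ/2}(1+4/δ)⁴`; `A_out` of `abs_transport_tail_sub_le_outer`) — FREE OF `N`. [folklore] -/
theorem abs_transport_tail_sub_le {K w : EKer 4} {C c δ : ℝ} {N : ℕ} (hN : 1 ≤ N) (hδ : 0 < δ) (hc : 0 ≤ c)
    (hK : ∀ c' e (t : Pt), |K c' e t| ≤ C / ((supNorm t : ℝ) + 1) ^ 6)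
    (hdK : ∀ c' e (t : Pt) (i : Fin 4), |K c' e (t + Pi.single i 1) - K c' e t| ≤ C / ((supNorm t : ℝ) + 1) ^ 7)
    (hw0 : ∀ κ l, ConstReproSum N (w κ l) (if κ = l then (((N : ℝ) ^ (4 + 1))⁻¹) else 0))
    (hw : ∀ κ l x, |w κ l x| ≤ c / (N : ℝ) ^ 5 * Real.exp (-(δ / N) * l1 x)) (a b : Fin 4) (v : Pt) :
    |(N : ℝ) ^ 8 * dressedEntry w (K - truncK K N) ((N : ℤ) • v) a b - (N : ℝ) ^ 6 * (K - truncK K N) a b ((N : ℤ) • v)|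
      ≤ ((4 : ℝ) ^ 7 * (16 * C * c ^ 2 * (Real.exp (δ / 2) * (1 + 4 / δ) ^ 4) ^ 2 + C)
          + (5 / 4 : ℝ) ^ 7 * (C * c ^ 2 * Real.exp (δ / 2) ^ 2 * (1 + 4 / δ) ^ 8
              * (128 * (4 / 3 : ℝ) ^ 7 * (2 / δ) + 4096 * 16 ^ 7 * 5040 * (2 / δ) ^ 7)))
        / ((supNorm v : ℝ) + 1) ^ 7 := by
  have hC := nonneg_of_decay hK a b
  set Acore : ℝ := 16 * C * c ^ 2 * (Real.exp (δ / 2) * (1 + 4 / δ) ^ 4) ^ 2 + C with hAcore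
  set Aout : ℝ := C * c ^ 2 * Real.exp (δ / 2) ^ 2 * (1 + 4 / δ) ^ 8
      * (128 * (4 / 3 : ℝ) ^ 7 * (2 / δ) + 4096 * 16 ^ 7 * 5040 * (2 / δ) ^ 7) with hAout
  have hAcore0 : 0 ≤ Acore := by positivity
  have hAout0 : 0 ≤ Aout := by positivity
  set n : ℝ := (supNorm v : ℝ) with hn
  have hn0 : 0 ≤ n := by positivity
  by_cases hv : 4 ≤ supNorm v
  · have h := abs_transport_tail_sub_le_outer hN hδ hc hK hdK hw0 hw a b hv
    refine h.trans ?_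
    have hn4 : (4 : ℝ) ≤ n := by rw [hn]; exact_mod_cast hv
    -- `Aout/n⁷ ≤ (5/4)⁷·Aout/(n+1)⁷ ≤ (4⁷·Acore + (5/4)⁷·Aout)/(n+1)⁷`
    have h1 : Aout / n ^ 7 ≤ (5 / 4 : ℝ) ^ 7 * Aout / (n + 1) ^ 7 := by
      rw [div_le_div_iff₀ (by positivity) (by positivity)]
      have key : (n + 1) ^ 7 ≤ ((5 / 4 : ℝ) * n) ^ 7 := pow_le_pow_left₀ (by positivity) (by linarith) 7
      calc Aout * (n + 1) ^ 7 ≤ Aout * ((5 / 4 : ℝ) * n) ^ 7 := mul_le_mul_of_nonneg_left key hAout0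
        _ = (5 / 4 : ℝ) ^ 7 * Aout * n ^ 7 := by ring
    refine h1.trans ?_
    rw [div_le_div_iff_of_pos_right (by positivity)]
    have : 0 ≤ (4 : ℝ) ^ 7 * Acore := by positivity
    linarith
  · have h := abs_transport_tail_le_core hN hδ hc hK hw a b v
    refine h.trans ?_
    have hn3 : n ≤ 3 := by
      have : supNorm v ≤ 3 := by omega
      rw [hn]; exact_mod_cast this
    rw [le_div_iff₀ (by positivity)]
    have key : (n + 1) ^ 7 ≤ (4 : ℝ) ^ 7 := pow_le_pow_left₀ (by positivity) (by linarith) 7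
    have : 0 ≤ (5 / 4 : ℝ) ^ 7 * Aout := by positivity
    calc Acore * (n + 1) ^ 7 ≤ Acore * (4 : ℝ) ^ 7 := mul_le_mul_of_nonneg_left key hAcore0
      _ ≤ (4 : ℝ) ^ 7 * Acore + (5 / 4 : ℝ) ^ 7 * Aout := by linarith

/-- [folklore] **DICTIONARY FOR THE ASSEMBLER**: at a coarse point the rescaled tail kernel is `K` off the unit core and `0` on it —
`(K − truncK K N) a b (N•v) = if ‖v‖∞ ≤ 1 then 0 else K a b (N•v)` (`N ≥ 1`; `‖N•v‖∞ = N‖v‖∞ ≤ N ↔ ‖v‖∞ ≤ 1`). -/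
theorem tail_apply_coarse {N : ℕ} (hN : 1 ≤ N) (K : EKer 4) (a b : Fin 4) (v : Pt) :
    (K - truncK K N) a b ((N : ℤ) • v) = if supNorm v ≤ 1 then 0 else K a b ((N : ℤ) • v) := by
  rw [tail_apply, supNorm_natCast_smul]
  by_cases h : supNorm v ≤ 1
  · rw [if_pos h, if_pos ((Nat.mul_le_mul_left N h).trans (Nat.mul_one N).le)]
  · rw [if_neg h, if_neg ?_]
    intro hle
    have h2 : 2 ≤ supNorm v := by omega
    have := (Nat.mul_le_mul_left N h2).trans hle
    omega

/-! ## §8 Summation against `v_μ v_ν` on `ℤ⁴`: quintic decay is summable, uniformly (finite windows, `Summable`, `tsum`) -/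

/-- **QUINTIC DECAY ON `ℤ⁴` IS ABSOLUTELY SUMMABLE, EVERY FINITE WINDOW UNIFORMLY BOUNDED**: `|g v| ≤ A·(‖v‖∞+1)⁻⁵` ⟹
`Σ_{v ∈ S} |g v| ≤ 161·A` for EVERY finite `S ⊆ ℤ⁴` (the origin `≤ A`, the shells by `TransferUV.abs_sum_le_of_quintic`: `#shell · (r+1)⁻⁵ ≤ 80(r+1)⁻²`). [folklore] -/
theorem sum_abs_le_of_quintic {g : Pt → ℝ} {A : ℝ} (hA : 0 ≤ A) (hg : ∀ v : Pt, |g v| ≤ A / ((supNorm v : ℝ) + 1) ^ 5)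
    (S : Finset Pt) : ∑ v ∈ S, |g v| ≤ 161 * A := by
  classical
  set M : ℕ := S.sup supNorm with hM
  -- split off the origin
  have hsub : S ⊆ insert (0 : Pt) (S.erase 0) := fun v hv => by
    by_cases h0 : v = 0
    · subst h0; exact Finset.mem_insert_self _ _
    · exact Finset.mem_insert_of_mem (Finset.mem_erase.mpr ⟨h0, hv⟩)
  have h1 : ∑ v ∈ S, |g v| ≤ |g 0| + ∑ v ∈ S.erase 0, |g v| := by
    refine (Finset.sum_le_sum_of_subset_of_nonneg hsub (fun _ _ _ => abs_nonneg _)).trans (le_of_eq ?_)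
    rw [Finset.sum_insert (Finset.notMem_erase 0 S)]
  -- the punctured part sits in the annulus `0 < ‖v‖∞ ≤ M`
  have hsub' : S.erase 0 ⊆ annulus 4 0 M := fun v hv => by
    obtain ⟨hv0, hvS⟩ := Finset.mem_erase.mp hv
    exact mem_annulus_iff.mpr ⟨supNorm_pos hv0, Finset.le_sup hvS⟩
  have h2 : ∑ v ∈ S.erase 0, |g v| ≤ ∑ v ∈ annulus 4 0 M, |g v| :=
    Finset.sum_le_sum_of_subset_of_nonneg hsub' (fun _ _ _ => abs_nonneg _)
  have h3 : ∑ v ∈ annulus 4 0 M, |g v| ≤ 160 * A := by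
    have h := TransferUV.abs_sum_le_of_quintic (M := M) (f := fun v => |g v|) hA (fun r z hz => by
      rw [abs_abs]
      refine (hg z).trans (div_le_div_of_nonneg_left hA (by positivity) ?_)
      rw [supNorm_eq_of_mem_sphere hz]; push_cast
      exact pow_le_pow_left₀ (by positivity) (by linarith) 5)
    exact (le_abs_self _).trans h
  have h0 : |g 0| ≤ A := by
    have := hg 0
    rw [supNorm_eq_zero_iff.mpr rfl, Nat.cast_zero, zero_add, one_pow, div_one] at this
    exact this
  linarith

/-- [folklore] … hence `Summable g`, `|Σ' g| ≤ 161·A`, and `|Σ_{v∈S} g v| ≤ 161·A` for every finite `S`. -/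
theorem summable_of_quintic {g : Pt → ℝ} {A : ℝ} (hA : 0 ≤ A) (hg : ∀ v : Pt, |g v| ≤ A / ((supNorm v : ℝ) + 1) ^ 5) :
    Summable g ∧ |∑' v, g v| ≤ 161 * A ∧ ∀ S : Finset Pt, |∑ v ∈ S, g v| ≤ 161 * A := by
  have hfin := sum_abs_le_of_quintic hA hg
  have habs : Summable fun v => |g v| := summable_of_sum_le (fun v => abs_nonneg _) hfin
  refine ⟨habs.of_abs, ?_, fun S => (Finset.abs_sum_le_sum_abs _ _).trans (hfin S)⟩
  have h1 : ‖∑' v, g v‖ ≤ ∑' v, ‖g v‖ := norm_tsum_le_tsum_norm (by simpa only [Real.norm_eq_abs] using habs)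
  simp only [Real.norm_eq_abs] at h1
  exact h1.trans (habs.tsum_le_of_sum_le hfin)

/-- **ROW H3-BOOK (b-T), SUMMED FORM (T2)**: with `A_T` the constant of `abs_transport_tail_sub_le`, the `v_μv_ν`-weighted difference
`g v := (v_μ v_ν)·(N⁸·dressedEntry w (K − truncK K N) (N•v) a b − N⁶·(K − truncK K N) a b (N•v))` satisfies `|g v| ≤ A_T·(‖v‖∞+1)⁻⁵`, hence is summable on
`ℤ⁴` with `|Σ' g| ≤ 161·A_T` AND `|Σ_{v∈S} g v| ≤ 161·A_T` for EVERY finite window `S` (in particular leaf-05's `annulus 4 1 R′`) — uniformly in `N ≥ 1`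
and in the window. [folklore] -/
theorem summable_weight_transport_tail_sub {K w : EKer 4} {C c δ : ℝ} {N : ℕ} (hN : 1 ≤ N) (hδ : 0 < δ) (hc : 0 ≤ c)
    (hK : ∀ c' e (t : Pt), |K c' e t| ≤ C / ((supNorm t : ℝ) + 1) ^ 6)
    (hdK : ∀ c' e (t : Pt) (i : Fin 4), |K c' e (t + Pi.single i 1) - K c' e t| ≤ C / ((supNorm t : ℝ) + 1) ^ 7)
    (hw0 : ∀ κ l, ConstReproSum N (w κ l) (if κ = l then (((N : ℝ) ^ (4 + 1))⁻¹) else 0))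
    (hw : ∀ κ l x, |w κ l x| ≤ c / (N : ℝ) ^ 5 * Real.exp (-(δ / N) * l1 x)) (a b μ ν : Fin 4) :
    let AT : ℝ := (4 : ℝ) ^ 7 * (16 * C * c ^ 2 * (Real.exp (δ / 2) * (1 + 4 / δ) ^ 4) ^ 2 + C)
          + (5 / 4 : ℝ) ^ 7 * (C * c ^ 2 * Real.exp (δ / 2) ^ 2 * (1 + 4 / δ) ^ 8
              * (128 * (4 / 3 : ℝ) ^ 7 * (2 / δ) + 4096 * 16 ^ 7 * 5040 * (2 / δ) ^ 7))
    let g : Pt → ℝ := fun v => ((v μ * v ν : ℤ) : ℝ)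
          * ((N : ℝ) ^ 8 * dressedEntry w (K - truncK K N) ((N : ℤ) • v) a b - (N : ℝ) ^ 6 * (K - truncK K N) a b ((N : ℤ) • v))
    (∀ v, |g v| ≤ AT / ((supNorm v : ℝ) + 1) ^ 5)
      ∧ Summable g ∧ |∑' v, g v| ≤ 161 * AT ∧ ∀ S : Finset Pt, |∑ v ∈ S, g v| ≤ 161 * AT := by
  intro AT g
  have hC := nonneg_of_decay hK a b
  have hAT : 0 ≤ AT := by positivity
  have hpt : ∀ v, |g v| ≤ AT / ((supNorm v : ℝ) + 1) ^ 5 := by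
    intro v
    have h := abs_transport_tail_sub_le hN hδ hc hK hdK hw0 hw a b v
    have hcoord : ∀ i : Fin 4, |((v i : ℤ) : ℝ)| ≤ (supNorm v : ℝ) + 1 := by
      intro i
      have h1 : ((v i).natAbs : ℝ) ≤ (supNorm v : ℝ) := by exact_mod_cast natAbs_le_supNorm v i
      have e : (((v i).natAbs : ℕ) : ℝ) = |((v i : ℤ) : ℝ)| := by rw [Nat.cast_natAbs]; push_cast; rfl
      rw [← e]; linarith
    have hvμ := hcoord μ
    have hvν := hcoord ν
    have hn : (0 : ℝ) < (supNorm v : ℝ) + 1 := by positivity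
    show |((v μ * v ν : ℤ) : ℝ) * _| ≤ _
    rw [abs_mul, Int.cast_mul, abs_mul]
    calc |((v μ : ℤ) : ℝ)| * |((v ν : ℤ) : ℝ)| * _ ≤ ((supNorm v : ℝ) + 1) * ((supNorm v : ℝ) + 1) * (AT / ((supNorm v : ℝ) + 1) ^ 7) :=
          mul_le_mul (mul_le_mul hvμ hvν (abs_nonneg _) hn.le) h (abs_nonneg _) (by positivity)
      _ = AT / ((supNorm v : ℝ) + 1) ^ 5 := by field_simp
  exact ⟨hpt, summable_of_quintic hAT hpt⟩

/-! ## §9 The split of the full transported kernel: `dressedEntry w K = dressedEntry w (truncK K N) + dressedEntry w (K − truncK K N)` -/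

/-- [folklore] A kernel with `|K| ≤ C(‖t‖∞+1)⁻⁶` is bounded by `C`; so is its truncation. -/
theorem abs_le_of_decay {K : EKer 4} {C : ℝ} (hK : ∀ c e (t : Pt), |K c e t| ≤ C / ((supNorm t : ℝ) + 1) ^ 6) (N : ℕ) (c e : Fin 4)
    (t : Pt) : |K c e t| ≤ C ∧ |truncK K N c e t| ≤ C := by
  have hC := nonneg_of_decay hK c e
  have h1 : |K c e t| ≤ C := by
    refine (hK c e t).trans (div_le_self hC ?_)
    exact one_le_pow₀ (by have := (Nat.cast_nonneg (supNorm t) : (0:ℝ) ≤ _); linarith)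
  refine ⟨h1, ?_⟩
  rw [truncK_apply]
  split_ifs
  · exact h1
  · rw [abs_zero]; exact hC

/-- **THE SPLIT (T3)**: for absolutely summable transport entries and `|K| ≤ C(‖t‖∞+1)⁻⁶`, entrywise and at every output point
`dressedEntry w (truncK K N) y a b + dressedEntry w (K − truncK K N) y a b = dressedEntry w K y a b` — so that leaf-02 g5's (a)
(`hasSum_coarse_secondMoment_truncK`) and (T2) above recombine to the full transported kernel of the (H1)-socket. [folklore] -/
theorem dressedEntry_truncK_add_tail {K w : EKer 4} {C : ℝ} {N : ℕ}
    (hK : ∀ c e (t : Pt), |K c e t| ≤ C / ((supNorm t : ℝ) + 1) ^ 6) (hwS : ∀ κ l, Summable fun x => |w κ l x|)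
    (y : Pt) (a b : Fin 4) :
    dressedEntry w (truncK K N) y a b + dressedEntry w (K - truncK K N) y a b = dressedEntry w K y a b := by
  unfold dressedEntry
  rw [← Finset.sum_add_distrib]
  refine Finset.sum_congr rfl (fun c _ => ?_)
  rw [← Finset.sum_add_distrib]
  refine Finset.sum_congr rfl (fun e _ => ?_)
  have hKs := summable_dressed_fibre_of_bounded (hwS c a) (fun t => (abs_le_of_decay hK N c e t).1) (hwS e b) y
  have hTs := summable_dressed_fibre_of_bounded (hwS c a) (fun t => (abs_le_of_decay hK N c e t).2) (hwS e b) y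
  have h := dressedSum_sub (w := w c a) (w' := w e b) (T := K c e) (T' := truncK K N c e) y hKs hTs
  have e1 : (K - truncK K N) c e = K c e - truncK K N c e := rfl
  rw [e1, h]
  ring

end Everywhere

end Summit.QuantumFields.BalabanUV.Beta.FP.HorizontalBookkeepingTailSum

end
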